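import Mathlib
import Summits.KontsevichZagierPeriods.KontsevichZagierPeriods.Theorems.SoloInformedStuffle
import Summits.KontsevichZagierPeriods.KontsevichZagierPeriods.Theorems.SoloInformedSumFormula
import Summits.KontsevichZagierPeriods.KontsevichZagierPeriods.Theorems.SoloInformedZetaTwo
import Summits.KontsevichZagierPeriods.KontsevichZagierPeriods.Theorems.SoloInformedZetaTwoTwoSum
import HarnessLib
import HarnessLib.Audit

/-!
# PROGRAMME XLV — Euler's `ζ(2) = π²/6`, `ζ(4) = π⁴/90·(…)`, `ζ(6) = π⁶/945` inside `𝒫`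

`𝒫 = KZ.FormalPeriodRing` is the ring of formal periods modulo the three Kontsevich–Zagier rules,
`mzvClass s = Z(s)` the class of Kontsevich's simplex representation of `ζ(s)` and `⟦D̄⟧` the
class of the closed unit disc (`KZ.piRep`, value `π`). Everything below is an identity IN `𝒫`,
assembled from three families of move-proved identities already in the tree and nothing else:

* THEOREM XL (fiberwise shuffle `Z(a)Z(b) = ∑_M #{σ : M_σ = M}·Z(a+b−M, M)`, the multiplicities
  counted by the kernel), THEOREM XLI (stuffle `Z(a)Z(b) = Z(a,b) + Z(b,a) + Z(a+b)`),
  THEOREM XXXIX (sum formula `∑_{i} Z(i+2, m+2−i) = Z(m+4)`);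
* THEOREM (s3x) `6·[Z□] ≡ [D̄]²` for the Beukers–Calabi–Kolk square `Z□ = ∫∫ dxdy/(1−xy)`, and the
  cube representation `CubeZ 0` of PROGRAMME XLI, whose class is `Z(2)` by the Nash blow-down.

Results.
1. `soloInformed_cubeZ_zero_eq_zetaTwoRep`: `CubeZ 0 = Z□` literally, hence
   **`⟦D̄⟧² = 6·Z(2)`** (`soloInformed_piClass_sq`) — `ζ(2) = π²/6` with Kontsevich's simplex class.
2. Weight 4: `Z(2)² = 2Z(2,2) + 4Z(3,1)` (24 permutations counted), `Z(2)² = 2Z(2,2) + Z(4)`,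
   and with the weight-4 cyclicity of the telescope programme (`soloInformed_mzvClass_weight4_cyclic`)
   `4Z(2,2) = 3Z(4)`, **`2·Z(2)² = 5·Z(4)`**.
3. Weight 6 (720 permutations counted twice): `Z(2)Z(4) = Z(2,4) + 2Z(3,3) + 4Z(4,2) + 8Z(5,1)`,
   `Z(3)² = 2Z(3,3) + 6Z(4,2) + 12Z(5,1)`; with the stuffles and the sum formula:
   `12Z(5,1) + 6Z(4,2) = Z(6)`, the Gangl–Kaneko–Zagier sums **`4(Z(5,1) + Z(3,3)) = Z(6)`**,
   **`4(Z(4,2) + Z(2,4)) = 3Z(6)`**, Euler's **`4·Z(2)Z(4) = 7·Z(6)`**, **`8·Z(2)³ = 35·Z(6)`**, the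
   depth-two table `12·Z(a,b) ∈ ℤZ(6) + ℤZ(5,1)`, and finally
   **THEOREM XLV `⟦D̄⟧⁶ = 945·Z(6)`** — Euler's `ζ(6) = π⁶/945` is a Kontsevich–Zagier relation
   (`soloInformed_pi_pow_six_sub_mem_relations`: `[D̄]²[D̄]²[D̄]² − 945·[Z(6)] ∈ KZ.relations`), with numerical shadow
   `π⁶ = 945·ζ(6)` read off by soundness (`soloInformed_pi_pow_six_eq`).

References: Euler 1740; Gangl–Kaneko–Zagier 2006, Thm. 1 (`∑ ζ(ev,ev) = ¾ζ(k)`,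
`∑ ζ(od,od) = ¼ζ(k)`); Kontsevich–Zagier 2001 §1.2 [KontsevichZagier2001]; Zagier 1994 §9.
-/

noncomputable section

open MeasureTheory Set
open Literature.ModelTheory.ExponentialFields Literature.NumberTheory.Transcendental
open Literature.NumberTheory.Transcendental.KZ

namespace Summit.KontsevichZagierPeriods.KontsevichZagierPeriods.Theorems

/-! ## 1. `ζ(2) = π²/6` with Kontsevich's simplex class -/

/-- The cube representation `CubeZ 0 = [(0,1)², 1/(1 − x₀x₁)]` of PROGRAMME XLI is literally the
Beukers–Calabi–Kolk square representation `Z□` of THEOREM (ζ(2) = π²/6). -/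
theorem soloInformed_cubeZ_zero_eq_zetaTwoRep : soloInformedCubeZ 0 = soloInformedZetaTwoRep := by
  refine IntegralRep.ext' (Set.ext fun z => ?_) (funext fun z => ?_)
  · show z ∈ soloInformedOpenCube (0 + 2) ↔ z ∈ soloInformedOpenSq
    simp only [soloInformedOpenCube, soloInformedOpenSq, mem_setOf_eq, mem_Ioo]
  · show soloInformedCubeZf 0 z = 1 / (1 - z 0 * z 1)
    simp only [soloInformedCubeZf, soloInformedPrefixProd, Finset.prod_filter, Fin.le_last, if_true]
    exact congrArg (fun t : ℝ => 1 / (1 - t)) (Fin.prod_univ_two z)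

/-- **`⟦D̄⟧² = 6·Z(2)` in `𝒫`** — `ζ(2) = π²/6` between the class of the disc and Kontsevich's
simplex class `Z(2) = ⟦[0<t₂<t₁<1, dt₁dt₂/(t₁(1−t₂))]⟧`. [KZ 2001 §1.2; Beukers–Calabi–Kolk 1993] -/
theorem soloInformed_piClass_sq : toFormalPeriod (of piRep) ^ 2 = 6 • mzvClass [2] := by
  have h := toFormalPeriod_eq_iff.2 soloInformed_six_zetaTwo_sub_pi_mul_pi_mem_relations
  rw [map_nsmul, map_mul, ← soloInformed_cubeZ_zero_eq_zetaTwoRep,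
    soloInformed_cubeZ_class (c := 0)] at h
  rw [sq, ← h]

/-! ## 2. Weight 4 -/

/-- `Z(2)·Z(2) = 2Z(2,2) + 4Z(3,1)` (THEOREM XL; the `6 = 4 + 2` shuffles counted by the kernel). -/
theorem soloInformed_w4_shuffle :
    mzvClass [2] * mzvClass [2] = 2 • mzvClass [2, 2] + 4 • mzvClass [3, 1] := by
  have c0 : ((Finset.univ.filter (soloInformedCompat (soloInformedShPoset 0 0))).filter
      (fun σ => soloInformedShM σ = 0)).card = 0 := by decide
  have c1 : ((Finset.univ.filter (soloInformedCompat (soloInformedShPoset 0 0))).filter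
      (fun σ => soloInformedShM σ = 1)).card = 4 := by decide
  have c2 : ((Finset.univ.filter (soloInformedCompat (soloInformedShPoset 0 0))).filter
      (fun σ => soloInformedShM σ = 2)).card = 2 := by decide
  rw [show mzvClass [2] = mzvClass [0 + 2] from rfl, soloInformed_mzvClass_shuffle_count 0 0]
  simp only [show 0 + 0 + 3 = 3 from rfl, show 0 + 0 + 4 = 4 from rfl, Finset.sum_range_succ,
    Finset.sum_range_zero, zero_add, c0, c1, c2, zero_smul, Nat.reduceSub]
  abel

/-- `Z(2)·Z(2) = 2Z(2,2) + Z(4)` (THEOREM XLI). -/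
theorem soloInformed_w4_stuffle :
    mzvClass [2] * mzvClass [2] = 2 • mzvClass [2, 2] + mzvClass [4] := by
  rw [show mzvClass [2] = mzvClass [0 + 2] from rfl, soloInformed_mzvClass_stuffle 0 0]
  simp only [show 0 + 0 + 4 = 4 from rfl, Nat.reduceAdd]
  abel

/-- `4·Z(2,2) = 3·Z(4)` in `𝒫` (from the weight-4 cyclicity `Z(2,2) = 3Z(3,1)`, `Z(4) = 4Z(3,1)`
of the telescope programme). -/
theorem soloInformed_w4_four_Z22 : 4 • mzvClass [2, 2] = 3 • mzvClass [4] := by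
  obtain ⟨h4, h22, -⟩ := soloInformed_mzvClass_weight4_cyclic
  rw [h22, h4, smul_smul, smul_smul, Nat.mul_comm]

/-- **Euler at weight 4 in `𝒫`: `2·Z(2)² = 5·Z(4)`.** -/
theorem soloInformed_two_Z2_sq : 2 • mzvClass [2] ^ 2 = 5 • mzvClass [4] := by
  rw [sq, soloInformed_w4_stuffle, smul_add, ← mul_nsmul', soloInformed_w4_four_Z22]
  abel

/-! ## 3. Weight 6 -/

/-- `Z(2)·Z(4) = Z(2,4) + 2Z(3,3) + 4Z(4,2) + 8Z(5,1)` (THEOREM XL; `15 = 1 + 2 + 4 + 8` shuffles,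
counted among the `720` permutations by the kernel). -/
theorem soloInformed_w6_shuffle24 :
    mzvClass [2] * mzvClass [4] =
      mzvClass [2, 4] + 2 • mzvClass [3, 3] + 4 • mzvClass [4, 2] + 8 • mzvClass [5, 1] := by
  have c0 : ((Finset.univ.filter (soloInformedCompat (soloInformedShPoset 0 2))).filter
      (fun σ => soloInformedShM σ = 0)).card = 0 := by
    set_option maxRecDepth 100000 in decide
  have c1 : ((Finset.univ.filter (soloInformedCompat (soloInformedShPoset 0 2))).filter
      (fun σ => soloInformedShM σ = 1)).card = 8 := by
    set_option maxRecDepth 100000 in decide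
  have c2 : ((Finset.univ.filter (soloInformedCompat (soloInformedShPoset 0 2))).filter
      (fun σ => soloInformedShM σ = 2)).card = 4 := by
    set_option maxRecDepth 100000 in decide
  have c3 : ((Finset.univ.filter (soloInformedCompat (soloInformedShPoset 0 2))).filter
      (fun σ => soloInformedShM σ = 3)).card = 2 := by
    set_option maxRecDepth 100000 in decide
  have c4 : ((Finset.univ.filter (soloInformedCompat (soloInformedShPoset 0 2))).filter
      (fun σ => soloInformedShM σ = 4)).card = 1 := by
    set_option maxRecDepth 100000 in decide
  rw [show mzvClass [2] = mzvClass [0 + 2] from rfl, show mzvClass [4] = mzvClass [2 + 2] from rfl,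
    soloInformed_mzvClass_shuffle_count 0 2]
  simp only [show 0 + 2 + 3 = 5 from rfl, show 0 + 2 + 4 = 6 from rfl, Finset.sum_range_succ,
    Finset.sum_range_zero, zero_add, c0, c1, c2, c3, c4, zero_smul, one_smul, Nat.reduceSub]
  abel

/-- `Z(3)·Z(3) = 2Z(3,3) + 6Z(4,2) + 12Z(5,1)` (THEOREM XL; `20 = 2 + 6 + 12` shuffles). -/
theorem soloInformed_w6_shuffle33 :
    mzvClass [3] * mzvClass [3] =
      2 • mzvClass [3, 3] + 6 • mzvClass [4, 2] + 12 • mzvClass [5, 1] := by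
  have c0 : ((Finset.univ.filter (soloInformedCompat (soloInformedShPoset 1 1))).filter
      (fun σ => soloInformedShM σ = 0)).card = 0 := by
    set_option maxRecDepth 100000 in decide
  have c1 : ((Finset.univ.filter (soloInformedCompat (soloInformedShPoset 1 1))).filter
      (fun σ => soloInformedShM σ = 1)).card = 12 := by
    set_option maxRecDepth 100000 in decide
  have c2 : ((Finset.univ.filter (soloInformedCompat (soloInformedShPoset 1 1))).filter
      (fun σ => soloInformedShM σ = 2)).card = 6 := by
    set_option maxRecDepth 100000 in decide
  have c3 : ((Finset.univ.filter (soloInformedCompat (soloInformedShPoset 1 1))).filter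
      (fun σ => soloInformedShM σ = 3)).card = 2 := by
    set_option maxRecDepth 100000 in decide
  have c4 : ((Finset.univ.filter (soloInformedCompat (soloInformedShPoset 1 1))).filter
      (fun σ => soloInformedShM σ = 4)).card = 0 := by
    set_option maxRecDepth 100000 in decide
  rw [show mzvClass [3] = mzvClass [1 + 2] from rfl, soloInformed_mzvClass_shuffle_count 1 1]
  simp only [show 1 + 1 + 3 = 5 from rfl, show 1 + 1 + 4 = 6 from rfl, Finset.sum_range_succ,
    Finset.sum_range_zero, zero_add, add_zero, c0, c1, c2, c3, c4, zero_smul, Nat.reduceSub]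
  abel

/-- `Z(2)·Z(4) = Z(2,4) + Z(4,2) + Z(6)` (THEOREM XLI). -/
theorem soloInformed_w6_stuffle24 :
    mzvClass [2] * mzvClass [4] = mzvClass [2, 4] + mzvClass [4, 2] + mzvClass [6] := by
  rw [show mzvClass [2] = mzvClass [0 + 2] from rfl, show mzvClass [4] = mzvClass [2 + 2] from rfl,
    soloInformed_mzvClass_stuffle 0 2]

/-- `Z(3)·Z(3) = 2Z(3,3) + Z(6)` (THEOREM XLI). -/
theorem soloInformed_w6_stuffle33 :
    mzvClass [3] * mzvClass [3] = 2 • mzvClass [3, 3] + mzvClass [6] := by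
  rw [show mzvClass [3] = mzvClass [1 + 2] from rfl, soloInformed_mzvClass_stuffle 1 1]
  simp only [show 1 + 1 + 4 = 6 from rfl, Nat.reduceAdd]
  abel

/-- `Z(2,4) + Z(3,3) + Z(4,2) + Z(5,1) = Z(6)` (THEOREM XXXIX). -/
theorem soloInformed_w6_sum :
    mzvClass [2, 4] + mzvClass [3, 3] + mzvClass [4, 2] + mzvClass [5, 1] = mzvClass [6] := by
  have h := soloInformed_mzvClass_sumFormula_m 2
  simp only [Finset.sum_range_succ, Finset.sum_range_zero, zero_add] at h
  exact h

/-- `12·Z(5,1) + 6·Z(4,2) = Z(6)` in `𝒫` (the double shuffle of `Z(3)·Z(3)`). -/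
theorem soloInformed_w6_Z51Z42 : 12 • mzvClass [5, 1] + 6 • mzvClass [4, 2] = mzvClass [6] := by
  have h := soloInformed_w6_shuffle33.symm.trans soloInformed_w6_stuffle33
  have h' : 12 • mzvClass [5, 1] + 6 • mzvClass [4, 2]
      = 2 • mzvClass [3, 3] + mzvClass [6] - 2 • mzvClass [3, 3] := by
    rw [← h]; abel
  rw [h']; abel

/-- `2·Z(3,3) + 3·Z(4,2) + 8·Z(5,1) = Z(6)` in `𝒫` (the double shuffle of `Z(2)·Z(4)`). -/
theorem soloInformed_w6_ds24 :
    2 • mzvClass [3, 3] + 3 • mzvClass [4, 2] + 8 • mzvClass [5, 1] = mzvClass [6] := by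
  have h := soloInformed_w6_shuffle24.symm.trans soloInformed_w6_stuffle24
  have h' : 2 • mzvClass [3, 3] + 3 • mzvClass [4, 2] + 8 • mzvClass [5, 1]
      = mzvClass [2, 4] + mzvClass [4, 2] + mzvClass [6] - mzvClass [2, 4] - mzvClass [4, 2] := by
    rw [← h]; abel
  rw [h']; abel

/-- **Gangl–Kaneko–Zagier's odd–odd sum at weight 6, in `𝒫`: `4·(Z(5,1) + Z(3,3)) = Z(6)`.**
[Gangl–Kaneko–Zagier 2006, Thm. 1] -/
theorem soloInformed_w6_oddodd : 4 • (mzvClass [5, 1] + mzvClass [3, 3]) = mzvClass [6] := by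
  have h1 := soloInformed_w6_Z51Z42
  have h2 := soloInformed_w6_ds24
  have h3 : 4 • (mzvClass [5, 1] + mzvClass [3, 3])
      = 2 • (2 • mzvClass [3, 3] + 3 • mzvClass [4, 2] + 8 • mzvClass [5, 1])
        - (12 • mzvClass [5, 1] + 6 • mzvClass [4, 2]) := by
    abel
  rw [h3, h1, h2]; abel

/-- **Gangl–Kaneko–Zagier's even–even sum at weight 6, in `𝒫`: `4·(Z(4,2) + Z(2,4)) = 3·Z(6)`.**
[Gangl–Kaneko–Zagier 2006, Thm. 1; Euler] -/
theorem soloInformed_w6_eveneven : 4 • (mzvClass [4, 2] + mzvClass [2, 4]) = 3 • mzvClass [6] := by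
  have h1 := soloInformed_w6_sum
  have h2 := soloInformed_w6_oddodd
  have h3 : 4 • (mzvClass [4, 2] + mzvClass [2, 4])
      = 4 • (mzvClass [2, 4] + mzvClass [3, 3] + mzvClass [4, 2] + mzvClass [5, 1])
        - 4 • (mzvClass [5, 1] + mzvClass [3, 3]) := by
    abel
  rw [h3, h1, h2]; abel

/-- **Euler in `𝒫`: `4·Z(2)·Z(4) = 7·Z(6)`** (`ζ(2)ζ(4) = 7ζ(6)/4`). -/
theorem soloInformed_four_Z2_mul_Z4 : 4 • (mzvClass [2] * mzvClass [4]) = 7 • mzvClass [6] := by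
  rw [soloInformed_w6_stuffle24, show mzvClass [2, 4] + mzvClass [4, 2] + mzvClass [6]
      = (mzvClass [4, 2] + mzvClass [2, 4]) + mzvClass [6] by abel, smul_add,
    soloInformed_w6_eveneven]
  abel

/-- **`8·Z(2)³ = 35·Z(6)` in `𝒫`.** -/
theorem soloInformed_eight_Z2_cube : 8 • mzvClass [2] ^ 3 = 35 • mzvClass [6] := by
  have h4 := soloInformed_two_Z2_sq
  have h6 := soloInformed_four_Z2_mul_Z4
  simp only [nsmul_eq_mul, Nat.cast_ofNat] at h4 h6 ⊢
  linear_combination 4 * mzvClass [2] * h4 + 5 * h6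

/-- The depth-two classes of weight 6 modulo `Z(6)`, `Z(5,1)`: `6Z(4,2) = Z(6) − 12Z(5,1)`,
`4Z(3,3) = Z(6) − 4Z(5,1)`, `12Z(2,4) = 7Z(6) + 24Z(5,1)`. -/
theorem soloInformed_w6_depth2 :
    6 • mzvClass [4, 2] = mzvClass [6] - 12 • mzvClass [5, 1] ∧
      4 • mzvClass [3, 3] = mzvClass [6] - 4 • mzvClass [5, 1] ∧
        12 • mzvClass [2, 4] = 7 • mzvClass [6] + 24 • mzvClass [5, 1] := by
  have h1 := soloInformed_w6_Z51Z42
  have h2 := soloInformed_w6_oddodd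
  have h3 := soloInformed_w6_eveneven
  refine ⟨?_, ?_, ?_⟩
  · rw [← h1]; abel
  · rw [← h2]; abel
  · have e : 12 • mzvClass [2, 4] = 3 • (4 • (mzvClass [4, 2] + mzvClass [2, 4]))
        - 2 • (6 • mzvClass [4, 2]) := by abel
    rw [e, h3, show 6 • mzvClass [4, 2] = mzvClass [6] - 12 • mzvClass [5, 1] by rw [← h1]; abel]
    abel

/-- **The depth-two table of weight 6**: for `a + b = 6`, `a ≥ 2`, `b ≥ 1`,
`12·Z(a,b) ∈ ℤ·Z(6) + ℤ·Z(5,1)` in `𝒫`. -/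
theorem soloInformed_mzvClass_weight6_depth2_table {a b : ℕ} (ha : 2 ≤ a) (hb : 1 ≤ b)
    (hab : a + b = 6) :
    ∃ x y : ℤ, 12 • mzvClass [a, b] = x • mzvClass [6] + y • mzvClass [5, 1] := by
  obtain ⟨h42, h33, h24⟩ := soloInformed_w6_depth2
  simp only [nsmul_eq_mul, Nat.cast_ofNat] at h42 h33 h24
  have key : (a = 5 ∧ b = 1) ∨ (a = 4 ∧ b = 2) ∨ (a = 3 ∧ b = 3) ∨ (a = 2 ∧ b = 4) := by omega
  rcases key with ⟨rfl, rfl⟩ | ⟨rfl, rfl⟩ | ⟨rfl, rfl⟩ | ⟨rfl, rfl⟩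
  · exact ⟨0, 12, by simp⟩
  · refine ⟨2, -24, ?_⟩
    rw [nsmul_eq_mul, zsmul_eq_mul, zsmul_eq_mul]
    push_cast
    linear_combination 2 * h42
  · refine ⟨3, -12, ?_⟩
    rw [nsmul_eq_mul, zsmul_eq_mul, zsmul_eq_mul]
    push_cast
    linear_combination 3 * h33
  · refine ⟨7, 24, ?_⟩
    rw [nsmul_eq_mul, zsmul_eq_mul, zsmul_eq_mul]
    push_cast
    linear_combination h24

/-! ## 4. THEOREM XLV — `ζ(6) = π⁶/945` is a Kontsevich–Zagier relation -/

/-- **THEOREM XLV (`⟦D̄⟧⁶ = 945·Z(6)` in `𝒫`).** Euler's `ζ(6) = π⁶/945` holds between the class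
of the unit disc and Kontsevich's simplex class of `ζ(6)`, by moves only. -/
theorem soloInformed_piClass_pow_six : toFormalPeriod (of piRep) ^ 6 = 945 • mzvClass [6] := by
  have h2 := soloInformed_piClass_sq
  have h6 := soloInformed_eight_Z2_cube
  simp only [nsmul_eq_mul, Nat.cast_ofNat] at h2 h6 ⊢
  linear_combination (toFormalPeriod (of piRep) ^ 4 + 6 * toFormalPeriod (of piRep) ^ 2 * mzvClass [2]
    + 36 * mzvClass [2] ^ 2) * h2 + 27 * h6

/-- **THEOREM XLV, kernel form in `ℤ[reps]`: `[D̄]²·[D̄]²·[D̄]² − 945·[Z(6)] ∈ KZ.relations`.** -/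
theorem soloInformed_pi_pow_six_sub_mem_relations :
    of piRep * of piRep * (of piRep * of piRep) * (of piRep * of piRep) -
      945 • of (mzvRep [6] (by decide) (mzvIntegrand_isSemialgebraicFunOn_holds _)
        (mzvIntegrand_integrableOn_holds _ (by decide))) ∈ relations := by
  rw [← toFormalPeriod_eq_iff, map_nsmul, ← mzvClass_of_isAdmissible]
  simp only [map_mul, ← soloInformed_piClass_pow_six]
  ring

/-- Numerical shadow by soundness (`evalP`): **`π⁶ = 945·ζ(6)`**, no integral having been computed
beyond the moves. -/
theorem soloInformed_pi_pow_six_eq : Real.pi ^ 6 = 945 * multipleZeta [6] := by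
  have h := congrArg evalP soloInformed_piClass_pow_six
  rwa [map_pow, map_nsmul, evalP_toFormalPeriod_of, piRep_value, evalP_mzvClass (by decide),
    nsmul_eq_mul, Nat.cast_ofNat] at h

/-- Numerical shadow: **`4·ζ(2)ζ(4) = 7·ζ(6)`**. -/
theorem soloInformed_four_zeta2_zeta4 : 4 * (multipleZeta [2] * multipleZeta [4]) = 7 * multipleZeta [6] := by
  have h := congrArg evalP soloInformed_four_Z2_mul_Z4
  rwa [map_nsmul, map_nsmul, map_mul, evalP_mzvClass (by decide), evalP_mzvClass (by decide),
    evalP_mzvClass (by decide), nsmul_eq_mul, nsmul_eq_mul, Nat.cast_ofNat, Nat.cast_ofNat] at h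

end Summit.KontsevichZagierPeriods.KontsevichZagierPeriods.Theorems
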